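import Literature.NumberTheory.EllipticCurves.PAdicOneVariableNormCoherentUnitEquivarianceTwo
import Literature.NumberTheory.GaloisRepresentations.LubinTateTowerCharacterCells
import HarnessLib

/-!
# `p = 2`: the pulled-back log-free measures `D_β = comap ν_β♭ ψ` of the norm-coherent units are
# `U_0`-EQUIVARIANT — the hypothesis `hD` of de Shalit's coset extension `induce` (I.3.4 / II.4.6)

Topic `NumberTheory/EllipticCurves`; namespace `Literature.NumberTheory.EllipticCurves`.

De Shalit, *Iwasawa theory of elliptic curves with complex multiplication* (1987), I.3.4 Lemma (ii) and the
extension to `𝒢` ("if `γU ⊂ G` define `μ_β(U) = μ_{γ(β)}(γU)` … independent of `γ`"): the family `β ↦ μ_β` is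
equivariant.  With `ν_β♭` the unit-ball measure of the log-free series of `β` read through `ϑ` and `Θ`
(`PAdicOneVariableNormCoherentUnitEquivarianceTwo.lean`: `ν_{σβ}♭(κ(σ) b) = ν_β♭(b)`), the Lubin–Tate tower
`𝒰 = ltTower hπ'` with `κ = e ∘ χ_{π'}` and cell maps `ψ` (`LubinTateTowerCharacterCells.lean`), and the abstract
`GroupDistribution.comap_family_equivariant_of_character` (`ProfiniteGroupDistributionCharacterCells.lean`):

* ★★★ `comap_μ_proj_mul_normCoherentUnits` — for ANY `Γ_F`-set `B` mapping equivariantly to the norm-coherent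
  units (`η (σ • b) = (η b).galAct σ`) and a uniform coefficient bound: for `h ∈ U_0` and every cell `a ⊆ U_0`,
  **`D_{h•b}(h̄ a) = D_b(a)`**, `D_b := comap ν_{η b}♭ ψ` — the `U_0`-equivariance feeding `GroupDistribution.induce`.

Everything is proved; no named facts, no definitions, no instances (section-local instance attributes as in the
siblings), no `sorry`.

## References

* [deShalit1987] E. de Shalit, *Iwasawa theory of elliptic curves with complex multiplication* (1987),
  I.3.4 Lemma (ii) and the extension to `𝒢` (p. 18), II.4.6 (12)–(14) (p. 59).
-/

noncomputable section

open MvPowerSeries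
open scoped Classical

namespace Literature.NumberTheory.EllipticCurves

section NormCoherentUnitComapEquivariantTwo

open ValuativeRel IsLocalRing Field
open Literature.NumberTheory.GaloisRepresentations Literature.NumberTheory.GaloisRepresentations.IsNonarchimedeanLocalField
  Literature.NumberTheory.GaloisRepresentations.LubinTate Literature.NumberTheory.PAdicHodge

variable {F : Type} [Field F] [ValuativeRel F] [TopologicalSpace F] [IsNonarchimedeanLocalField F]

attribute [local instance] ltNormUniformSpace ltNormIsUniformAddGroup rk1 nF nE fintypeResidueField
attribute [local instance] ltTower_U_normal

variable (hq : residueFieldCard F = 2) (h2 : (valuation F).IsUniformizer (((2 : ℕ) : 𝒪[F]) : F))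
  {σ₀ : absoluteGaloisGroup F} (hσ₀ : IsAbsArithFrob σ₀) (u : 𝒪[F]ˣ)
  {ε : (maxUnramifiedCompletion F)ˣ}
  (hε : maxUnramifiedCompletion.galAut F σ₀ (ε : maxUnramifiedCompletion F) =
    algebraMap 𝒪[F] (maxUnramifiedCompletion F) (u : 𝒪[F]) * (ε : maxUnramifiedCompletion F))
variable {𝕜 : Type*} [NormedField 𝕜] [NormedAlgebra ℚ_[2] 𝕜] [IsUltrametricDist 𝕜] [CompleteSpace 𝕜]
  (Θ : UnrCoeff F →+* 𝕜) (e : 𝒪[F] ≃+* ℤ_[2])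
  (hΘe : ∀ a : 𝒪[F], Θ (intToUnrCoeff F a) = padicIntCast 𝕜 ((e : 𝒪[F] →+* ℤ_[2]) a))
variable {B : Type*} [SMul (absoluteGaloisGroup F) B]
  (η : B → NormCoherentUnits (isUniformizer_unit_mul h2 u))
  (hη : ∀ (σ : absoluteGaloisGroup F) (b : B), η (σ • b) = (η b).galAct σ)
  {C : ℝ}
  (hC : ∀ (b : B) (k : ℕ), ‖PowerSeries.coeff k ((PowerSeries.subst (compSeriesC h2 hσ₀ u hε)
    ((tildeSer ((u : 𝒪[F]) * ((2 : ℕ) : 𝒪[F])) (LTCoeff.of F (u : 𝒪[F])) (η b).logDeriv).map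
      ((intToUnrCoeff F).comp (LTCoeff.of F).symm.toRingHom))).map Θ)‖ ≤ C)
  (ψ : (n : ℕ) → absoluteGaloisGroup F ⧸ (ltTower (isUniformizer_unit_mul h2 u)).U n → ZMod (2 ^ (n + 1)))
  (hψ : ∀ (n : ℕ) (σ : absoluteGaloisGroup F), σ ∈ (ltTower (isUniformizer_unit_mul h2 u)).U 0 →
    ψ n ((ltTower (isUniformizer_unit_mul h2 u)).proj n σ) = PadicInt.toZModPow (n + 1)
      (((Units.map (e : 𝒪[F] →+* ℤ_[2]).toMonoidHom).comp (lubinTateCharHom (isUniformizer_unit_mul h2 u)) σ :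
        ℤ_[2]ˣ) : ℤ_[2]))

include hq hΘe hη in
/-- ★★★ **`U_0`-equivariance of the pulled-back log-free measures of the norm-coherent units** (tower of
`f' = π'X + X²`, `π' = 2u`, `κ = e ∘ χ_{π'}`): for `h ∈ U_0 = Gal(F̄/K_{π'}^1)`, `b ∈ B` and every level-`n` cell
`a ⊆ U_0`, **`(comap ν_{h•b}♭ ψ)(h̄ · a) = (comap ν_b♭ ψ)(a)`** — the hypothesis `hD` of `GroupDistribution.induce`
(de Shalit's extension of `β ↦ μ_β` from `G` to `𝒢`). [cite: deShalit1987, I.3.4 Lemma (ii) (p. 18), II.4.6 (14) (p. 59)] -/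
theorem comap_μ_proj_mul_normCoherentUnits :
    ∀ h ∈ (ltTower (isUniformizer_unit_mul h2 u)).U 0, ∀ (b : B) (n : ℕ)
      (a : absoluteGaloisGroup F ⧸ (ltTower (isUniformizer_unit_mul h2 u)).U n),
      (ltTower (isUniformizer_unit_mul h2 u)).transLE (Nat.zero_le n) a = 1 →
      (GroupDistribution.comap (restrictUnits ((invAmice₁ 2 ((PowerSeries.subst (compSeriesC h2 hσ₀ u hε)
          ((tildeSer ((u : 𝒪[F]) * ((2 : ℕ) : 𝒪[F])) (LTCoeff.of F (u : 𝒪[F])) (η (h • b)).logDeriv).map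
            ((intToUnrCoeff F).comp (LTCoeff.of F).symm.toRingHom))).map Θ) (hC (h • b))).density
          (ProfiniteTower.padicInt_isUniform 2) (unitInv 𝕜) uniformContinuous_unitInv norm_unitInv_le))
          ψ ((ltTower (isUniformizer_unit_mul h2 u)).cellMap_trans _ ψ hψ)
          ((ltTower (isUniformizer_unit_mul h2 u)).cellMap_injective _
            (mem_ltTower_iff (isUniformizer_unit_mul h2 u) e) ψ hψ)
          ((ltTower (isUniformizer_unit_mul h2 u)).cellMap_fiberSurj _
            (mem_ltTower_iff (isUniformizer_unit_mul h2 u) e)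
            (exists_toZModPow_ltCharacter_eq (isUniformizer_unit_mul h2 u) e) ψ hψ)).μ n
          ((ltTower (isUniformizer_unit_mul h2 u)).proj n h * a) =
        (GroupDistribution.comap (restrictUnits ((invAmice₁ 2 ((PowerSeries.subst (compSeriesC h2 hσ₀ u hε)
          ((tildeSer ((u : 𝒪[F]) * ((2 : ℕ) : 𝒪[F])) (LTCoeff.of F (u : 𝒪[F])) (η b).logDeriv).map
            ((intToUnrCoeff F).comp (LTCoeff.of F).symm.toRingHom))).map Θ) (hC b)).density
          (ProfiniteTower.padicInt_isUniform 2) (unitInv 𝕜) uniformContinuous_unitInv norm_unitInv_le))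
          ψ ((ltTower (isUniformizer_unit_mul h2 u)).cellMap_trans _ ψ hψ)
          ((ltTower (isUniformizer_unit_mul h2 u)).cellMap_injective _
            (mem_ltTower_iff (isUniformizer_unit_mul h2 u) e) ψ hψ)
          ((ltTower (isUniformizer_unit_mul h2 u)).cellMap_fiberSurj _
            (mem_ltTower_iff (isUniformizer_unit_mul h2 u) e)
            (exists_toZModPow_ltCharacter_eq (isUniformizer_unit_mul h2 u) e) ψ hψ)).μ n a := by
  refine GroupDistribution.comap_family_equivariant_of_character _
    (fun b ↦ restrictUnits ((invAmice₁ 2 ((PowerSeries.subst (compSeriesC h2 hσ₀ u hε)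
      ((tildeSer ((u : 𝒪[F]) * ((2 : ℕ) : 𝒪[F])) (LTCoeff.of F (u : 𝒪[F])) (η b).logDeriv).map
        ((intToUnrCoeff F).comp (LTCoeff.of F).symm.toRingHom))).map Θ) (hC b)).density
      (ProfiniteTower.padicInt_isUniform 2) (unitInv 𝕜) uniformContinuous_unitInv norm_unitInv_le))
    (mem_ltTower_iff (isUniformizer_unit_mul h2 u) e) (exists_toZModPow_ltCharacter_eq (isUniformizer_unit_mul h2 u) e)
    ψ hψ ?_
  intro h _ b n c
  have key := restrictUnits_density_unitInv_μ_unitMul_normCoherentUnits_galAct hq h2 hσ₀ u hε Θ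
    (e : 𝒪[F] →+* ℤ_[2]) hΘe h (η b) (hC b) (by rw [← hη]; exact hC (h • b)) n c
  simp only [hη]
  convert key using 3
  rfl

end NormCoherentUnitComapEquivariantTwo

end Literature.NumberTheory.EllipticCurves

end
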